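import Mathlib
import HarnessLib
import Literature.MathematicalPhysics.StatisticalMechanics.LennardJonesClusters
import Literature.Barriers.AtomisticToContinuum.IcosahedralClusters

/-!
# Crux `GroundStateVarianceCertificate` (stmt-AtomisticToContinuum-11859), line `registered` —
# stub `stub_smallClusters`: the variance certificate for small clusters `N ≤ 4`

For `N ≤ 4` particles every Lennard-Jones ground state `x` in `ℝ³` is a unit simplex: all pair
distances equal the equilibrium distance `1`.  Indeed `V_LJ ≥ -1/12` termwise
(`neg_one_div_le_lennardJones`), while the first `N` vertices of the fcc tetrahedron
`fccTetrahedron` (pairwise at distance `1`, `dist_fccTetrahedron`) form an injective competitor of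
energy `#pairs · (-1/12)`; so the ground-state energy is squeezed, the pair terms are all `-1/12`,
and `V_LJ(r) = -1/12 ↔ r = 1` (`lennardJones_eq_neg_inv_twelve_iff`).  Consequently the site sums
`sᵢ = ∑_{k ≠ i} r_{ik}⁻⁶` and `tᵢ = ∑_{k ≠ i} r_{ik}⁻¹²` both equal `N - 1`, and
`∑ᵢ sᵢ² = N (N - 1)² ≤ 3 · N (N - 1) = 3 · ∑ᵢ tᵢ` because `N - 1 ≤ 3`.

This is the small-cluster case of the periodic domination of the ground-state variance quotient
(the skeleton `GroundStateVarianceCertificate_of` consumes it verbatim as `stub_smallClusters`).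
Sources: Blanc–Lewin 2015, §1.1 (3) for the normalisation of `V_LJ`; the rest is folklore.
-/

noncomputable section

open Literature.MathematicalPhysics.StatisticalMechanics

namespace Summit.AtomisticToContinuum.Crystallization.Theorems.GroundStateVarianceCertificateLine

/-- In a Lennard-Jones ground state of `N ≤ 4` particles in `ℝ³` all pair distances equal `1`:
the first `N` vertices of the unit fcc tetrahedron are a competitor of energy `#pairs · (-1/12)`,
the termwise lower bound `V_LJ ≥ -1/12` then forces every pair term to be `-1/12`, and the well
is attained only at `r = 1`. [folklore] -/
theorem dist_eq_one_of_isGroundState_of_le_four {N : ℕ} (hN : N ≤ 4)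
    {x : Fin N → EuclideanSpace ℝ (Fin 3)} (hx : IsGroundState lennardJones x)
    {i j : Fin N} (hij : i ≠ j) : dist (x i) (x j) = 1 := by
  -- the competitor: the first `N` vertices of the unit fcc tetrahedron
  have hyinj : Function.Injective fun k : Fin N =>
      Literature.Barriers.AtomisticToContinuum.fccTetrahedron (Fin.castLE hN k) :=
    Literature.Barriers.AtomisticToContinuum.fccTetrahedron_injective.comp (Fin.castLE_injective hN)
  have hEy : interactionEnergy lennardJones
      (fun k : Fin N => Literature.Barriers.AtomisticToContinuum.fccTetrahedron (Fin.castLE hN k)) =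
        ∑ i : Fin N, ∑ _j ∈ Finset.Ioi i, (-1 / 12 : ℝ) := by
    unfold interactionEnergy
    refine Finset.sum_congr rfl fun i _ => Finset.sum_congr rfl fun j hj => ?_
    rw [Literature.Barriers.AtomisticToContinuum.dist_fccTetrahedron fun h =>
      (ne_of_lt (Finset.mem_Ioi.1 hj)) (Fin.castLE_injective hN h), lennardJones_one]
  -- termwise lower bound and global upper bound force termwise equality
  have hle : ∀ i ∈ (Finset.univ : Finset (Fin N)), ∑ _j ∈ Finset.Ioi i, (-1 / 12 : ℝ) ≤
      ∑ j ∈ Finset.Ioi i, lennardJones (dist (x i) (x j)) :=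
    fun i _ => Finset.sum_le_sum fun j _ => neg_one_div_le_lennardJones _
  have hup : ∑ i : Fin N, ∑ j ∈ Finset.Ioi i, lennardJones (dist (x i) (x j)) ≤
      ∑ i : Fin N, ∑ _j ∈ Finset.Ioi i, (-1 / 12 : ℝ) := by
    change interactionEnergy lennardJones x ≤ _
    rw [hx.2, ← hEy]
    exact groundStateEnergy_lennardJones_le hyinj
  have hsum : ∑ i : Fin N, ∑ _j ∈ Finset.Ioi i, (-1 / 12 : ℝ) =
      ∑ i : Fin N, ∑ j ∈ Finset.Ioi i, lennardJones (dist (x i) (x j)) :=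
    le_antisymm (Finset.sum_le_sum hle) hup
  have hrow := (Finset.sum_eq_sum_iff_of_le hle).1 hsum
  -- reduce to the case `i < j`
  wlog hlt : i < j generalizing i j
  · rw [dist_comm]
    exact this hij.symm (lt_of_le_of_ne (not_lt.1 hlt) hij.symm)
  have hi := hrow i (Finset.mem_univ i)
  have hterm := (Finset.sum_eq_sum_iff_of_le fun j _ =>
    neg_one_div_le_lennardJones (dist (x i) (x j))).1 hi j (Finset.mem_Ioi.2 hlt)
  exact (Literature.Barriers.AtomisticToContinuum.lennardJones_eq_neg_inv_twelve_iff
    dist_nonneg).1 hterm.symm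

/-- If all pair distances of a configuration of `N` points equal `1`, then every inverse-power
site sum `∑_{k ≠ i} r_{ik}⁻ⁿ` equals `N - 1`. [folklore] -/
theorem siteEnergy_inv_pow_eq_of_dist_eq_one {N : ℕ} {x : Fin N → EuclideanSpace ℝ (Fin 3)}
    (h1 : ∀ i j : Fin N, i ≠ j → dist (x i) (x j) = 1) (n : ℕ) (i : Fin N) :
    siteEnergy (fun r => (r⁻¹) ^ n) x i = (N : ℝ) - 1 := by
  simp only [siteEnergy]
  have hterm : ∀ k ∈ Finset.univ.erase i, (dist (x i) (x k))⁻¹ ^ n = (1 : ℝ) := fun k hk => by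
    rw [h1 i k (Finset.ne_of_mem_erase hk).symm, inv_one, one_pow]
  rw [Finset.sum_congr rfl hterm, Finset.sum_const, Finset.card_erase_of_mem (Finset.mem_univ i),
    Finset.card_univ, Fintype.card_fin, nsmul_eq_mul, mul_one, Nat.cast_pred (Fin.pos i)]

/-- The arithmetic of the small-cluster certificate: `N (N - 1)² ≤ 3 · N (N - 1)` for `N ≤ 4`.
[folklore] -/
theorem cast_mul_sq_le_of_le_four {N : ℕ} (hN : N ≤ 4) :
    (N : ℝ) * ((N : ℝ) - 1) ^ 2 ≤ 3 * ((N : ℝ) * ((N : ℝ) - 1)) := by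
  interval_cases N <;> norm_num

/-- **Stub 2b `stub_smallClusters` (small clusters) of crux `GroundStateVarianceCertificate`,
line `registered`.** For `N ≤ 4` particles every Lennard-Jones ground state in `ℝ³` is a unit
simplex (all mutual distances `1`), whence `sᵢ = tᵢ = N - 1` and
`∑ᵢ sᵢ² = N (N - 1)² ≤ 3 · N (N - 1) = 3 · ∑ᵢ tᵢ`. [folklore] -/
theorem stub_smallClusters :
    ∀ (N : ℕ) (x : Fin N → EuclideanSpace ℝ (Fin 3)), N ≤ 4 → IsGroundState lennardJones x →
      ∑ i, (siteEnergy (fun r => (r⁻¹) ^ 6) x i) ^ 2 ≤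
        3 * ∑ i, siteEnergy (fun r => (r⁻¹) ^ 12) x i := by
  intro N x hN hx
  have h1 : ∀ i j : Fin N, i ≠ j → dist (x i) (x j) = 1 := fun i j hij =>
    dist_eq_one_of_isGroundState_of_le_four hN hx hij
  have h6 : ∀ i, siteEnergy (fun r => (r⁻¹) ^ 6) x i = (N : ℝ) - 1 :=
    siteEnergy_inv_pow_eq_of_dist_eq_one h1 6
  have h12 : ∀ i, siteEnergy (fun r => (r⁻¹) ^ 12) x i = (N : ℝ) - 1 :=
    siteEnergy_inv_pow_eq_of_dist_eq_one h1 12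
  simp only [h6, h12, Finset.sum_const, Finset.card_univ, Fintype.card_fin, nsmul_eq_mul]
  exact cast_mul_sq_le_of_le_four hN

end Summit.AtomisticToContinuum.Crystallization.Theorems.GroundStateVarianceCertificateLine

end
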